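import Summits.KontsevichZagierPeriods.Zeta5Search.Certificates.PolyReflectElim
import Summits.KontsevichZagierPeriods.Zeta5Search.Certificates.PolyReflectNorm
import HarnessLib

/-!
# Shadow bounds of an elimination run (cell `pub-zeta5`, certifier `cert-2`)

HONEST FRAMING: systematic search; no irrationality claim unless certified.

OUR infrastructure (Summit side). The shape/1-norm bounds of `Certificates/PolyReflectNorm` propagated through the linear
layer of `Certificates/PolyReflectElim`: entries of `lcSmul`, `lcAdd`, one `elimStep`, and a whole `elimRun` — the SHADOW
`elimShadow rels st S` (computable on sizes only) bounds the row lengths, block lengths and 1-norms of every entry of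
`elimRun rels st E` (`lcFits_elimRun`), starting from the measured bounds `lcMeasure`. Used by `Certificates/PolyReflectPack`.
No Prop-valued definitions (the "fits" predicates are kept inline). No mathematics specific to ζ(5) lives here.
-/

namespace Summit.KontsevichZagierPeriods.Zeta5Search.PolyReflect

/-! ### Shapes of linear combinations and of one elimination step -/

/-! An `LC` FITS `(W, X, H)` when every entry has shape `(W, X)` and norm `≤ H`:
`∀ c ∈ E, (∀ b ∈ c, b.length ≤ X ∧ ∀ r ∈ b, r.length ≤ W) ∧ norm3 c ≤ H` (kept inline). -/

/-- `lcGet` of a fitting combination fits. -/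
theorem lcFits_get {W X H : ℕ} : ∀ (E : LC) (s : ℕ), (∀ c ∈ E, (∀ b ∈ c, b.length ≤ X ∧ ∀ r ∈ b, r.length ≤ W) ∧ norm3 c ≤ H) → (∀ b ∈ (lcGet E s), b.length ≤ X ∧ ∀ r ∈ b, r.length ≤ W) ∧ norm3 (lcGet E s) ≤ H
  | [], _, _ => ⟨sh3_nil _ _, by simp [lcGet]⟩
  | c :: E, 0, h => h c (by simp)
  | c :: E, s + 1, h => lcFits_get E s fun d hd => h d (by simp [hd])

/-- Entries of `lcSmul a E`. -/
theorem lcFits_smul {Wa Xa Ha W X H : ℕ} (ha : 1 ≤ Wa ∧ 1 ≤ Xa) (hE : 1 ≤ W ∧ 1 ≤ X) (a : Poly3)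
    (hsa : (∀ b ∈ a, b.length ≤ Xa ∧ ∀ r ∈ b, r.length ≤ Wa)) (hna : norm3 a ≤ Ha) :
    ∀ E : LC, (∀ c ∈ E, (∀ b ∈ c, b.length ≤ X ∧ ∀ r ∈ b, r.length ≤ W) ∧ norm3 c ≤ H) → (∀ c ∈ (lcSmul a E), (∀ b ∈ c, b.length ≤ (Xa + X - 1) ∧ ∀ r ∈ b, r.length ≤ (Wa + W - 1)) ∧ norm3 c ≤ (Ha * H))
  | [], _ => by simp [lcSmul]
  | c :: E, h => by
    intro d hd
    simp only [lcSmul, List.mem_cons] at hd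
    rcases hd with rfl | hd
    · have hc := h c (by simp)
      exact ⟨sh3_mul3 ha.1 ha.2 hE.1 hE.2 a c hsa hc.1,
        (norm3_mul3 a c).trans (Nat.mul_le_mul hna hc.2)⟩
    · exact lcFits_smul ha hE a hsa hna E (fun e he => h e (by simp [he])) d hd

/-- Entries of `lcAdd E F`. -/
theorem lcFits_add {W X H H' : ℕ} : ∀ E F : LC, (∀ c ∈ E, (∀ b ∈ c, b.length ≤ X ∧ ∀ r ∈ b, r.length ≤ W) ∧ norm3 c ≤ H) → (∀ c ∈ F, (∀ b ∈ c, b.length ≤ X ∧ ∀ r ∈ b, r.length ≤ W) ∧ norm3 c ≤ H') → (∀ c ∈ (lcAdd E F), (∀ b ∈ c, b.length ≤ X ∧ ∀ r ∈ b, r.length ≤ W) ∧ norm3 c ≤ (H + H'))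
  | [], F, _, hF => fun c hc => by
    have := hF c (by simpa [lcAdd] using hc); exact ⟨this.1, this.2.trans (by omega)⟩
  | a :: E, [], hE, _ => fun c hc => by
    have := hE c (by simpa [lcAdd] using hc); exact ⟨this.1, this.2.trans (by omega)⟩
  | a :: E, b :: F, hE, hF => by
    intro c hc
    simp only [lcAdd, List.mem_cons] at hc
    rcases hc with rfl | hc
    · have ha := hE a (by simp); have hb := hF b (by simp)
      exact ⟨sh3_add3 a b ha.1 hb.1, (norm3_add3 a b).trans (Nat.add_le_add ha.2 hb.2)⟩
    · exact lcFits_add E F (fun e he => hE e (by simp [he])) (fun e he => hF e (by simp [he])) c hc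

/-- **One elimination step**: if `E` fits `(W, X, H)` and the multiplier `a` together with the relation `R` fit
`(WR, XR, HR)` (all bounds `≥ 1`), then `elimStep a R s E` fits `(WR + W − 1, XR + X − 1, 2·HR·H)`. -/
theorem lcFits_elimStep {W X H WR XR HR : ℕ} (hW : 1 ≤ W) (hX : 1 ≤ X) (hWR : 1 ≤ WR) (hXR : 1 ≤ XR)
    (a : Poly3) (R : LC) (s : ℕ) (E : LC)
    (hE : ∀ c ∈ E, (∀ b ∈ c, b.length ≤ X ∧ ∀ r ∈ b, r.length ≤ W) ∧ norm3 c ≤ H)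
    (hR : ∀ c ∈ a :: R, (∀ b ∈ c, b.length ≤ XR ∧ ∀ r ∈ b, r.length ≤ WR) ∧ norm3 c ≤ HR) :
    ∀ c ∈ elimStep a R s E, (∀ b ∈ c, b.length ≤ XR + X - 1 ∧ ∀ r ∈ b, r.length ≤ WR + W - 1) ∧
      norm3 c ≤ 2 * (HR * H) := by
  have ha := hR a (by simp)
  have hR' : ∀ c ∈ R, (∀ b ∈ c, b.length ≤ XR ∧ ∀ r ∈ b, r.length ≤ WR) ∧ norm3 c ≤ HR :=
    fun c hc => hR c (by simp [hc])
  have hc := lcFits_get E s hE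
  have h1 := lcFits_smul ⟨hWR, hXR⟩ ⟨hW, hX⟩ a ha.1 ha.2 E hE
  have h2 := lcFits_smul ⟨hW, hX⟩ ⟨hWR, hXR⟩ (neg3 (lcGet E s)) (sh3_neg3 hW hX _ hc.1)
    ((norm3_neg3 _).trans hc.2) R hR'
  rw [show W + WR - 1 = WR + W - 1 by omega, show X + XR - 1 = XR + X - 1 by omega,
    show H * HR = HR * H by ring] at h2
  have := lcFits_add _ _ h1 h2
  rw [elimStep]; simpa [two_mul] using this

/-! ### Measured shapes (computable) and the shadow of an elimination run -/

/-- Maximal row length of a `Poly2`. -/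
def maxRow2 : Poly2 → ℕ
  | [] => 0
  | r :: p => max r.length (maxRow2 p)

/-- Maximal row length of a `Poly3`. -/
def maxRow3 : Poly3 → ℕ
  | [] => 0
  | b :: p => max (maxRow2 b) (maxRow3 p)

/-- Maximal block length (number of rows) of a `Poly3`. -/
def maxBlk3 : Poly3 → ℕ
  | [] => 0
  | b :: p => max b.length (maxBlk3 p)

/-- `(∀ r ∈ p, r.length ≤ (maxRow2 p))`. -/
theorem rows_maxRow2 : ∀ p : Poly2, (∀ r ∈ p, r.length ≤ (maxRow2 p))
  | [] => by simp
  | r :: p => by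
    rw [rows_cons, maxRow2]
    exact ⟨le_max_left _ _, rows_mono (rows_maxRow2 p) (le_max_right _ _)⟩

/-- `(∀ b ∈ p, b.length ≤ (maxBlk3 p) ∧ ∀ r ∈ b, r.length ≤ (maxRow3 p))`. -/
theorem sh3_measured : ∀ p : Poly3, (∀ b ∈ p, b.length ≤ (maxBlk3 p) ∧ ∀ r ∈ b, r.length ≤ (maxRow3 p))
  | [] => sh3_nil _ _
  | b :: p => by
    rw [sh3_cons, maxRow3, maxBlk3]
    exact ⟨⟨le_max_left _ _, rows_mono (rows_maxRow2 b) (le_max_left _ _)⟩,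
      sh3_mono (sh3_measured p) (le_max_right _ _) (le_max_right _ _)⟩

/-- Measured bounds `(W, X, H)` of a combination (all `≥ 1`). -/
def lcMeasure : LC → ℕ × ℕ × ℕ
  | [] => (1, 1, 1)
  | c :: E => let m := lcMeasure E; (max (maxRow3 c) m.1, max (maxBlk3 c) m.2.1, max (norm3 c) m.2.2)

/-- The measured bounds are `≥ 1`. -/
theorem one_le_lcMeasure : ∀ E : LC, 1 ≤ (lcMeasure E).1 ∧ 1 ≤ (lcMeasure E).2.1 ∧ 1 ≤ (lcMeasure E).2.2
  | [] => by simp [lcMeasure]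
  | c :: E => by
    have := one_le_lcMeasure E
    simp only [lcMeasure]
    exact ⟨this.1.trans (le_max_right _ _), this.2.1.trans (le_max_right _ _), this.2.2.trans (le_max_right _ _)⟩

/-- A combination fits its measured bounds. -/
theorem lcFits_measure : ∀ E : LC, ∀ c ∈ E,
    (∀ b ∈ c, b.length ≤ (lcMeasure E).2.1 ∧ ∀ r ∈ b, r.length ≤ (lcMeasure E).1) ∧ norm3 c ≤ (lcMeasure E).2.2
  | [] => by simp
  | c :: E => by
    intro d hd
    simp only [lcMeasure]
    rcases List.mem_cons.1 hd with rfl | hd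
    · exact ⟨sh3_mono (sh3_measured d) (le_max_left _ _) (le_max_left _ _), le_max_left _ _⟩
    · have h := lcFits_measure E d hd
      exact ⟨sh3_mono h.1 (le_max_right _ _) (le_max_right _ _), h.2.trans (le_max_right _ _)⟩

/-- The SHADOW of an elimination run: bounds `(W, X, H)` valid for every entry of `elimRun rels st E`,
computed from the measured bounds of `E` and of the relations used (cheap; for `decide`). -/
def elimShadow (rels : List LC) : List (ℕ × ℕ × Poly3) → ℕ × ℕ × ℕ → ℕ × ℕ × ℕ
  | [], S => S
  | (r, _, a) :: st, (W, X, H) =>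
    let m := lcMeasure (a :: rels.getD r [])
    elimShadow rels st (m.1 + W - 1, m.2.1 + X - 1, 2 * (m.2.2 * H))

/-- **Soundness of the shadow**: every entry of `elimRun rels st E` fits `elimShadow rels st S` when `E` fits `S`
(bounds `≥ 1`). -/
theorem lcFits_elimRun (rels : List LC) :
    ∀ (st : List (ℕ × ℕ × Poly3)) (E : LC) (W X H : ℕ), 1 ≤ W → 1 ≤ X →
      (∀ c ∈ E, (∀ b ∈ c, b.length ≤ X ∧ ∀ r ∈ b, r.length ≤ W) ∧ norm3 c ≤ H) →
      ∀ c ∈ elimRun rels st E, (∀ b ∈ c, b.length ≤ (elimShadow rels st (W, X, H)).2.1 ∧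
        ∀ r ∈ b, r.length ≤ (elimShadow rels st (W, X, H)).1) ∧ norm3 c ≤ (elimShadow rels st (W, X, H)).2.2
  | [], E, W, X, H, _, _, h => by simpa [elimShadow, elimRun] using h
  | (r, s, a) :: st, E, W, X, H, hW, hX, h => by
    have hm := one_le_lcMeasure (a :: rels.getD r [])
    have hR := lcFits_measure (a :: rels.getD r [])
    simp only [elimShadow, elimRun]
    exact lcFits_elimRun rels st _ _ _ _ (by omega) (by omega) (lcFits_elimStep hW hX hm.1 hm.2.1 a _ s E h hR)

end Summit.KontsevichZagierPeriods.Zeta5Search.PolyReflect
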